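import Summits.MatrixMultiplication.OmegaCensus.DominoZ29StructFiveRowsA
import HarnessLib

/-!
# Structural part-`5` route at `p = 29`: rows `7`–`13` of the completeness check (file 2 of 4)

See `DominoZ29StructFiveRowsA.lean` (split rationale) and `DominoZ29Z29StructFiveCells.lean` (the cell theorems).  ω-census `pub-omega`, family (b3), seat
pub-omega-group gen 23; framing: lottery ticket, floor = certified bounds/negative ranges; NOT progress on ω.
-/

namespace Summit.MatrixMultiplication.OmegaCensus

open Finset ZpZpDomino Literature.Combinatorics.Additive

namespace ZpZpDomino

set_option maxHeartbeats 4000000 in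
/-- Row `b = 7` of the completeness check (`29²` lookups). [folklore] -/
theorem checkFiveRow_29_7 : checkFiveRow 29 ecZ29s5 tabTreeZ29s5 7 = true := by decide +kernel

set_option maxHeartbeats 4000000 in
/-- Row `b = 8` of the completeness check (`29²` lookups). [folklore] -/
theorem checkFiveRow_29_8 : checkFiveRow 29 ecZ29s5 tabTreeZ29s5 8 = true := by decide +kernel

set_option maxHeartbeats 4000000 in
/-- Row `b = 9` of the completeness check (`29²` lookups). [folklore] -/
theorem checkFiveRow_29_9 : checkFiveRow 29 ecZ29s5 tabTreeZ29s5 9 = true := by decide +kernel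

set_option maxHeartbeats 4000000 in
/-- Row `b = 10` of the completeness check (`29²` lookups). [folklore] -/
theorem checkFiveRow_29_10 : checkFiveRow 29 ecZ29s5 tabTreeZ29s5 10 = true := by decide +kernel

set_option maxHeartbeats 4000000 in
/-- Row `b = 11` of the completeness check (`29²` lookups). [folklore] -/
theorem checkFiveRow_29_11 : checkFiveRow 29 ecZ29s5 tabTreeZ29s5 11 = true := by decide +kernel

set_option maxHeartbeats 4000000 in
/-- Row `b = 12` of the completeness check (`29²` lookups). [folklore] -/
theorem checkFiveRow_29_12 : checkFiveRow 29 ecZ29s5 tabTreeZ29s5 12 = true := by decide +kernel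

set_option maxHeartbeats 4000000 in
/-- Row `b = 13` of the completeness check (`29²` lookups). [folklore] -/
theorem checkFiveRow_29_13 : checkFiveRow 29 ecZ29s5 tabTreeZ29s5 13 = true := by decide +kernel


end ZpZpDomino

end Summit.MatrixMultiplication.OmegaCensus
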